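import Mathlib
import HarnessLib
import HarnessLib.Audit
import Summits.NavierStokesRegularity.Statement
import Literature.Analysis.FluidPDE.ClassicalSolution
import Literature.Analysis.FluidPDE.LerayHopf
import Literature.Analysis.FluidPDE.SuitableWeak
import Literature.Analysis.FluidPDE.NSWave0
import Summits.NavierStokesRegularity.NavierStokesRegularity.Theorems.TypeICertificateLadderNoBlowupToClay
import HarnessLib.Audit.Status.Attr

/-!
Route: TypeIIInviscidRelaxation

Thesis X (card NavierStokesRegularity/NavierStokesRegularity/type-ii-inviscid-relaxation — "Type II
= infinite local Reynolds number; only inviscid rigidity survives"): it suffices to show the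
conjunction of four statements about finite-energy classical solutions from Clay data whose maximal
lifespan T is finite and whose rate is NOT Type I (P := IsMaximalSmoothSolution ν 0 u p T ∧
IsLerayHopfOn T ν 0 (u 0) u ∧ HasRapidSpatialDecay (u 0) ∧ ¬IsTypeIBlowup u T):
(R) RELAXATION DICHOTOMY — along times t_k ↑ T the flow, recentred at a near-maximum of |u|,
rotated, rescaled by a core length L and the speed bound V with local Reynolds number L·V/ν ≥ K → ∞,
is 1/K-close in C⁰ on K core radii to a profile W that is either AXISYMMETRIC (monopole column /
ring / Hou class) or COLUMNAR, W(y+τe₃)=W(y) (dipole / 2½-D / any 2-D relative equilibrium: Kerr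
class), W having unit-scale oscillation ≥ 1/4 (a genuine core, not a constant);
(AX₀) AxisymmetricSwirlRegularity (the named open conjecture; the exactly axisymmetric sub-case of
the monopole branch, since axisymmetric singularities are Type II by KNSS2009/SereginSverak2009);
(AX) given AX₀, no P-solution is frequently close to axisymmetric cores in the sense of (R);
(DP) no P-solution is frequently close to columnar cores.
Then NoTypeII (stmt-NavierStokesRegularity-0056, shared with route TypeILiouville) follows by pure
logic (proved in the planner's Sketch.lean: monotonicity of witnesses in K turns Frequently(M∪D)
into Frequently(M) ∨ Frequently(D)), and with the Type-I half (NoTypeIBlowup, = TypeILiouville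
0057+0058) and the shared local-theory assembly (stmt-…-0055) Clay (A) follows.
Lean (elaborates, Sketch.lean rc 0): X := TypeIICoreRelaxation ∧
Literature.Analysis.FluidPDE.AxisymmetricSwirlRegularity ∧ MonopoleCoreExclusion ∧
ColumnarCoreExclusion, with
TypeIICoreRelaxation := ∀ ν T > 0, ∀ u p, IsMaximalSmoothSolution ν 0 u p T → IsLerayHopfOn T ν 0 (u
0) u → HasRapidSpatialDecay (u 0) → ¬IsTypeIBlowup u T → ∀ K > 0, ∀ t₀ < T, ∃ t ∈ (t₀,T), ∃ x₀ L V
(Q : ℝ³ ≃ₗᵢ[ℝ] ℝ³) W, 0<L ∧ 0<V ∧ (IsAxisymmetric W ∨ ∀ y τ, W (y + τ•eZ) = W y) ∧ (∀ x, ‖u t x‖ ≤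
V) ∧ (∃ x₁, dist x₁ x₀ ≤ L ∧ V ≤ 2‖u t x₁‖) ∧ (∃ y y' ∈ B̄(0,1), 1/4 ≤ ‖W y − W y'‖) ∧ K ν ≤ L V ∧ ∀
‖y‖ ≤ K, ‖V⁻¹ • Q⁻¹ (u t (x₀ + L • Q y)) − W y‖ ≤ K⁻¹;
Assembly := TypeIICoreRelaxation → AxisymSwirlRegular → MonopoleCoreExclusion →
ColumnarCoreExclusion → NoTypeIBlowup → NoBlowupToClay → NavierStokesRegularity (proved by pure
logic in Sketch.lean, axioms propext/choice/Quot.sound).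

Rationale: WHY THIS LINE. Read the Type-I/Type-II split as a split of toolkits by the local Reynolds number
R(t)=(T−t)‖u(t)‖²∞/ν: Type I ⇔ R bounded (KNSS2009 normalisation; viscous Liouville world of route
TypeILiouville), Type II ⇔ R→∞, where every viscous payoff switches off relative to the core
turnover (plain diffusion by 1/R; even Gallay2018's optimal enhanced dissipation ν^{1/3} loses by
R_Γ^{-2/3}) and the zoom at the core scale is an EULER flow (in print: Seregin2024 =
arXiv:2304.04045 Prop 1.2, Seregin2024AxisymTypeII). The rigidity that survives Re→∞ is inviscid
damping / axisymmetrisation of vorticity-dominated cores (BedrossianCotizelatiVicol2019 linear;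
IonescuJia2021 nonlinear near the point vortex; RenEtAl2023; MoffattKidaOhkitani1994: strained
vortices become axisymmetric as R_Γ→∞; GallaySverak2024: vortex rings at high Re), acting on the
turnover clock with R→∞ turnovers left. Imported: 2-D Euler phase-mixing (dynamics) + blow-up
rescaling (PDE) + symmetry reduction; the conclusion is typed in the inviscid-damping topology
(velocity strong/C⁰, vorticity only weak), which is why the witnesses compare normalised VELOCITY
fields.
TWO-LAYER PLAN (D-0019). Layer 1 = the four ranked cruxes below + target NoTypeII (=stmt-0056) +
assembly; supports NoTypeIBlowup (Type-I half, owned by TypeILiouville/its cards) and NoBlowupToClay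
(=stmt-0055). Layer 2 (later, by glued splits once something closes): R ⇐ COHERENCE (Type II forces
a scale L with Re≥K carrying an O(1)-oscillation core near the speed maximum; fails for
sign-cancelling tangles) ∧ RELAXATION proper (coherent cores axisymmetrise or two-dimensionalise:
linear BCZV/Gallay–Maekawa around strained Lamb–Oseen/Batchelor columns → nonlinear Ionescu–Jia type
→ compactness); AX ⇐ quantitative axisymmetric regularity ∧ stability transfer at the core scale; DP
⇐ local one-component/anisotropic criterion (CheminZhang2016, WangWuZhang2023,
KukavicaRusinZiane2016, arXiv:2606.08352) ∧ curvature control.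
RANKED CRUXES. #2 AxisymSwirlRegular = Literature.Analysis.FluidPDE.AxisymmetricSwirlRegularity (the
unproved NAMED conjecture the monopole branch needs, ranked first per D-0019 practice: an exactly
axisymmetric blow-up is Type II and trivially M-witnessed; hardest, and its refutation (a rigorous
Hou2022PotentiallySingularNS singularity) is ¬A outright). #3 TypeIICoreRelaxation (the route's own
mechanism; where model evidence bites: Kerr flattening, Kirchhoff/tripole cores, Moffatt–Kimura
tents). #4 MonopoleCoreExclusion (conditional on #2: transfer to asymptotically axisymmetric cores).
#5 ColumnarCoreExclusion (2½-D/dipole branch).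
KILL CRITERIA. Any finite-energy Type-II blow-up from Schwartz data refutes the target and settles
¬A. A rigorous Hou-type axisymmetric singularity refutes #2 and closes the monopole branch (route
closes refuted:AxisymSwirlRegular). Model-level (refuter evidence, not formal): a Type-II scenario
whose core at diverging Re stays far in C⁰-velocity from both classes on K core radii (e.g.
persistent curved-sheet cores in antiparallel reconnection, MoffattKimura2019) makes #3
suspect-false → pivot #3 to a three-class dichotomy (add sheets) or close exhausted. If grounders
show the witness clauses admit spurious far-field witnesses, restate #3 with a vorticity floor (V =
a global speed bound attained in the ball is already required).
NOT DECOMPOSED YET. How R is proved (coherence lemma, linear/nonlinear damping around strained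
columns, compactness — Šverák-conjecture strength in general); the class bookkeeping inside AX/DP;
the dictionary/switch-off lemma (Type I ⇔ sup R<∞; enhanced rate/turnover ≤ C R_Γ^{-2/3}, one line
from Gallay2018) is Literature-grade support, to be filed as cite facts when a prover asks; no
definition request is load-bearing (witness predicate is inlined; a definitions agent may factor it
as `TypeIICoreWitness`).
PRIOR-PROGRAM NOTES: not read (plancard mode).

Novelty: NOVELTY (searched 2026-08-15: card audit refs re-read; `lit read arxiv:2304.04045` pp.1-8 and
arxiv:2402.13229 pp.1-3; zbMATH 'Seregin type II blowup' (3 hits: arXiv:2606.29468, Seregin lecture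
notes 2026, arXiv:2510.25448), 'axisymmetrization vortex inviscid damping Euler stability'
(RenEtAl2023 doi:10.1016/j.jfa.2023.109919, arXiv:2512.01730), 'stability of vortex rings vanishing
viscosity' (GallaySverak2024), 'regularity criterion one component' (CheminZhang2016,
WangWuZhang2023, KukavicaRusinZiane2016 + 9 more), `lit frontier NavierStokesRegularity --since
2022` (arXiv:2606.08352 finite-scale one-component regularity), hybrid local
(MoffattKidaOhkitani1994 via book:boratav1997 p.100-108); galaxy --star all attempted x3 (0 rows /
saturated, recorded)). Nearest prior art: Seregin2024 (arXiv:2304.04045) and Seregin2024AxisymTypeII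
(arXiv:2402.13229), arXiv:2507.08733, arXiv:2606.29468 — Type-II scenarios zoomed with the EULER
scaling, limit = ancient Euler flow in a Morrey class, exclusion ⇔ Euler Liouville theorems
(ingredient A in print); BedrossianCotizelatiVicol2019, IonescuJia2021, RenEtAl2023, Gallay2018,
GallaySverak2024 — inviscid damping/axisymmetrisation as 2-D (or axisymmetric-ring) theorems never
pointed at blow-up classification (ingredient B); arXiv:2606.07875 (unrefereed) claims a reduction
of first singularities to axisymmetric-with-swirl endpoints by an unrelated amplitude identity.
Delta: (i) the surviving rigidity is RELAXATION TO SYMMETRY (axisymmetric or  [refs: 10.1016/j.jfa.2023.109919, 2304.04045, 2402.13229, 2606.29468, 2510.25448, 2512.01730, 2606.08352, 2507.08733, 2606.07875, arxiv:2304.04045, arxiv:2402.13229, doi:10.1016/j.jfa.2023.109919, book:boratav1997, RenEtAl2023, GallaySverak2024, CheminZhang2016, WangWuZhang2023, KukavicaRusinZiane2016, MoffattKidaOhkitani1994, Seregin2024, BedrossianCotizelatiVicol2019, IonescuJia2021, Gallay2018]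

Barriers (technique_class: inviscid-damping type-ii-euler-scaling symmetry-reduction): technique_class: inviscid-damping type-ii-euler-scaling symmetry-reduction
- Literature.Barriers.NavierStokesRegularity.AxisymmetricTypeIExclusion: used as INPUT, not
contradicted — axisymmetric singularities are Type II (Seregin–Šverák 2009), which is exactly why
the monopole branch reduces to AxisymmetricSwirlRegularity (crux #2) plus a transfer statement (#4);
no Type-I axisymmetric scenario is posited anywhere.
- Literature.Barriers.NavierStokesRegularity.TaoAveragedBlowup: Tao's averaged blow-up is Type II
(arXiv:1402.0290 p.8 fn.), so NoTypeII-type statements cannot follow from energy identity +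
harmonic-analysis estimates; the route's cruxes are statements about fine structure an averaged
bilinear form B̃ does not possess — pointwise symmetry classes of the rescaled velocity field (R),
vorticity transport/phase mixing by differential rotation (the intended proof of R),
symmetry-reduced regularity (AX); honest status: nothing here is an estimate yet, and a proof of R
by compactness+energy alone would fall to the barrier.
- Literature.Barriers.NavierStokesRegularity.TruncatedDyadicTypeIBlowup: same class as above aimed
at rate statements; the target NoTypeII is a rate statement, and the route does not claim it from
function-space estimates but from a structural dichotomy; evaded in form only — the bet is that
relaxation (R) is provable by vorticity-geometry/phase-mixing arguments that have no dyadic shadow.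
- Literature.Barriers.NavierStokesRegularity.EnergySupercritical

sub-problem: NavierStokesRegularity · status: open · opened planner-plancard-NavierStokesRegularity-Navie-84fe4e4e-0 2026-08-15T11:00:07Z · rev 3 · ledger route-NavierStokesRegularity-TypeIIInviscidRelaxation
GENERATED by the gate from the ledger (D-0016/17). Provers cite these decls: `theorem foo : Summit.NavierStokesRegularity.NavierStokesRegularity.Theses.TypeIIInviscidRelaxation.<Decl> := …` in Summits/NavierStokesRegularity/NavierStokesRegularity/Theorems/<Name>.lean.
-/

namespace Summit.NavierStokesRegularity.NavierStokesRegularity.Theses.TypeIIInviscidRelaxation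

open scoped BigOperators Topology Manifold Classical MeasureTheory ProbabilityTheory Matrix InnerProductSpace ComplexConjugate ContinuousMap
open Filter Set Function TopologicalSpace MeasureTheory

attribute [summit_statement] _root_.NavierStokesRegularity

open Literature.NS

/-- item stmt-NavierStokesRegularity-0056 · target · rank 0 · open · by planner
why it might fail: A counterexample is a finite-energy Type-II singularity = ¬Clay(A); Tao's averaged-NS blow-up is Type II (arXiv:1402.0290 p.8 fn.) so no energy+harmonic-analysis proof exists; Hou's axisymmetric data (arXiv:2107.06509) would be Type II if singular (KNSS2009 p.4; knss_no_axisymmetric_typeI).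
sources: Tao2016AveragedNS, KochNadirashviliSereginSverak2009, Hou2022PotentiallySingularNS, Seregin2012, Seregin2024, Literature.Barriers.NavierStokesRegularity.TaoAveragedBlowup
If a finite-energy classical solution from a rapidly decaying datum has maximal lifespan T<∞ (no
classical extension past T), then ‖u(t)‖_∞ ≤ C (T−t)^{-1/2} eventually as t↑T (Leray's rate is the
matching lower bound, leray_blowup_rate_top). The hardest and most informative crux: a
counterexample is a Type II singularity, i.e. ¬(Clay A). Known: lower bound c√ν (T−t)^{-1/2} (Leray
1934 §20); L³ must blow up (ESS 2003, Seregin 2012); only triple-log quantitative gain (Tao 2021). -/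
@[route_item "route-NavierStokesRegularity-TypeIIInviscidRelaxation", crux]
def NoTypeII : Prop :=
  ∀ (ν T : ℝ), 0 < ν → 0 < T → ∀ (u : ℝ → EuclideanSpace ℝ (Fin 3) → EuclideanSpace ℝ (Fin 3)) (p : ℝ → EuclideanSpace ℝ (Fin 3) → ℝ), Literature.Analysis.FluidPDE.IsMaximalSmoothSolution ν 0 u p T → Literature.Analysis.FluidPDE.IsLerayHopfOn T ν 0 (u 0) u → Literature.Analysis.FluidPDE.HasRapidSpatialDecay (u 0) → Literature.Analysis.FluidPDE.IsTypeIBlowup u T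

/-- item stmt-NavierStokesRegularity-1964 · crux · rank 2 · open · by planner
why it might fail: It is the axisymmetric case of Clay (A): Hou's smooth axisymmetric-with-swirl data show sustained nearly self-similar growth (vorticity ×10^7, arXiv:2107.06509; Hou2026) — made rigorous, a Type-II singularity = its negation; only no-swirl, small/critical-swirl and weighted cases are theorems.
sources: Hou2022PotentiallySingularNS, Hou2026, KochNadirashviliSereginSverak2009, SereginSverak2009, ChenFangZhang2017, LeiZhang2011
[crux] The named open conjecture Literature.Analysis.FluidPDE.AxisymmetricSwirlRegularity (ns.S25:
global classical solutions with bounded energy for smooth divergence-free rapidly decaying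
AXISYMMETRIC data, swirl allowed), made an explicit item because the monopole branch needs it: an
exactly axisymmetric finite-energy blow-up is Type II (KNSS2009 p.4 / SereginSverak2009; in-tree
fact knss_no_axisymmetric_typeI) and is trivially witnessed in the axisymmetric class of
TypeIICoreRelaxation (Q=id, W = normalised u, error 0), so MonopoleCoreExclusion restricted to
axisymmetric data IS this conjecture modulo local theory. Known: no-swirl case (Ladyzhenskaya,
Ukhovskii–Yudovich; in-tree axisymmetric_no_swirl_global_regularity), |u|≤C/r and Γ∈L^∞_tL^p_x
Liouville cases (KNSS Thm 5.3, LeiZhang2011/2017), critical swirl smallness (ChenFangZhang2017).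
Shared item: any card on Hou's scenario attaches here. -/
@[route_item "route-NavierStokesRegularity-TypeIIInviscidRelaxation", crux]
def AxisymSwirlRegular : Prop :=
  ∀ ν : ℝ, 0 < ν → ∀ u₀ : EuclideanSpace ℝ (Fin 3) → EuclideanSpace ℝ (Fin 3), ContDiff ℝ (⊤ : ℕ∞) u₀ → Literature.Analysis.FluidPDE.VectorCalculus.IsDivFree u₀ → Literature.Analysis.FluidPDE.HasRapidSpatialDecay u₀ → (∀ (θ : ℝ) (x : EuclideanSpace ℝ (Fin 3)), u₀ (WithLp.toLp 2 ![Real.cos θ * x 0 - Real.sin θ * x 1, Real.sin θ * x 0 + Real.cos θ * x 1, x 2]) = WithLp.toLp 2 ![Real.cos θ * u₀ x 0 - Real.sin θ * u₀ x 1, Real.sin θ * u₀ x 0 + Real.cos θ * u₀ x 1, u₀ x 2]) → ∃ (u : ℝ → EuclideanSpace ℝ (Fin 3) → EuclideanSpace ℝ (Fin 3)) (p : ℝ → EuclideanSpace ℝ (Fin 3) → ℝ), Literature.Analysis.FluidPDE.IsClassicalNSSolutionOn (Set.Ici 0) ν 0 u p ∧ u 0 = u₀ ∧ Literature.Analysis.FluidPDE.HasBoundedEnergy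 u

/-- item stmt-NavierStokesRegularity-1963 · crux · rank 3 · open · by planner
why it might fail: (1) sign-cancelling tangle: no scale with Re≥K whose speed core is V/K-symmetric on K radii; (2) coherent but unrelaxed cores: antiparallel tubes FLATTEN into curved sheets (MoffattKimura2019), orthogonal/Kida–Pelz collisions are neither class; (3) nonlinear damping is only perturbative and 2-D.
sources: BedrossianCotizelatiVicol2019, IonescuJia2021, RenEtAl2023, Gallay2018, GallaySverak2024, MoffattKidaOhkitani1994
[crux] RELAXATION DICHOTOMY (card type-ii-inviscid-relaxation, ingredients C+R). For a finite-energy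
classical solution from Clay data with maximal lifespan T and NOT Type-I rate: for every K>0,
frequently as t↑T, there are a centre x₀, a core length L>0, a speed bound V (∀x ‖u(t,x)‖≤V,
attained within factor 2 in B̄(x₀,L)), a linear isometry Q and a profile W with unit-scale
oscillation ≥1/4, such that the local Reynolds number L·V/ν ≥ K and the normalised velocity y ↦
V⁻¹Q⁻¹u(t, x₀+L·Qy) is K⁻¹-close to W in C⁰ on ‖y‖≤K, where W is AXISYMMETRIC about e₃ (monopole
column / vortex ring / Hou-type core) OR COLUMNAR, W(y+τe₃)=W(y) (antiparallel dipole,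
Kirchhoff/tripole cores, any 2½-D flow). Mechanism: Type II ⇔ R(t)=(T−t)‖u‖²∞/ν→∞ ⇒ at the core
scale the zoom is Euler (Seregin2024 Prop 1.2) with R_Γ→∞ turnovers left; viscous payoffs are off
(enhanced dissipation/turnover ≤ C R_Γ^{-2/3}, Gallay2018), inviscid damping survives and drives
vorticity-dominated cores to 2-D Euler relative equilibria in exactly this topology (velocity
strong, vorticity weak): BedrossianCotizelatiVicol2019 (linear, general vortices), IonescuJia2021
(nonlinear near point vortex), RenEtAl2023, MoffattKidaOhk -/
@[route_item "route-NavierStokesRegularity-TypeIIInviscidRelaxation", crux]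
def TypeIICoreRelaxation : Prop :=
  ∀ (ν T : ℝ), 0 < ν → 0 < T → ∀ (u : ℝ → EuclideanSpace ℝ (Fin 3) → EuclideanSpace ℝ (Fin 3)) (p : ℝ → EuclideanSpace ℝ (Fin 3) → ℝ), Literature.Analysis.FluidPDE.IsMaximalSmoothSolution ν 0 u p T → Literature.Analysis.FluidPDE.IsLerayHopfOn T ν 0 (u 0) u → Literature.Analysis.FluidPDE.HasRapidSpatialDecay (u 0) → ¬ Literature.Analysis.FluidPDE.IsTypeIBlowup u T → ∀ K : ℝ, 0 < K → ∀ t₀ < T, ∃ t, t₀ < t ∧ t < T ∧ ∃ (x₀ : EuclideanSpace ℝ (Fin 3)) (L V : ℝ) (Q : EuclideanSpace ℝ (Fin 3) ≃ₗᵢ[ℝ] EuclideanSpace ℝ (Fin 3)) (W : EuclideanSpace ℝ (Fin 3) → EuclideanSpace ℝ (Fin 3)), 0 < L ∧ 0 < V ∧ ((∀ (θ : ℝ) (x : EuclideanSpace ℝ (Fin 3)), W (WithLp.toLp 2 ![Real.cos θ * x 0 - Real.sin θ * x 1, Real.sin θ * x 0 + Real.cos θ * x 1, x 2]) = WithLp.toLp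 2 ![Real.cos θ * W x 0 - Real.sin θ * W x 1, Real.sin θ * W x 0 + Real.cos θ * W x 1, W x 2]) ∨ ∀ (y : EuclideanSpace ℝ (Fin 3)) (τ : ℝ), W (y + τ • EuclideanSpace.single 2 1) = W y) ∧ (∀ x, ‖u t x‖ ≤ V) ∧ (∃ x₁, dist x₁ x₀ ≤ L ∧ V ≤ 2 * ‖u t x₁‖) ∧ (∃ y y' : EuclideanSpace ℝ (Fin 3), ‖y‖ ≤ 1 ∧ ‖y'‖ ≤ 1 ∧ (4 : ℝ)⁻¹ ≤ ‖W y - W y'‖) ∧ K * ν ≤ L * V ∧ ∀ y : EuclideanSpace ℝ (Fin 3), ‖y‖ ≤ K → ‖V⁻¹ • Q.symm (u t (x₀ + L • Q y)) - W y‖ ≤ K⁻¹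

/-- item stmt-NavierStokesRegularity-1965 · crux · rank 4 · open · by planner
why it might fail: AX₀ at fixed ν gives no quantitative stability at Re→∞: the core dynamics is nearly axisymmetric EULER with swirl, which can blow up (Elgindi2021 C^{1,α}; ChenHou2025 with boundary); rings/columns are stable only near special profiles; C⁰-closeness at sparse times controls nothing in between.
sources: GallaySverak2024, GallayMaekawa2010, BedrossianCotizelatiVicol2019, Seregin2024AxisymTypeII, Literature.Analysis.FluidPDE.Seregin2020_axisymmetricSingularPoint_typeII, Hou2022PotentiallySingularNS
[crux] MONOPOLE BRANCH (card's AX): GIVEN AxisymmetricSwirlRegularity, no finite-energy classical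
solution from Clay data with maximal lifespan T and non-Type-I rate admits, for every K>0 frequently
as t↑T, level-K witnesses of the AXISYMMETRIC class (same witness clauses as TypeIICoreRelaxation
with IsAxisymmetric W). Content beyond crux AxisymSwirlRegular: TRANSFER from exactly to
asymptotically axisymmetric cores at diverging local Reynolds number — the Hou class seen from
nearby non-symmetric data. Toolbox: quantitative axisymmetric regularity (critical swirl quantities
Γ=r u_θ, maximum principle), stability of columnar vortices and rings at high Re (GallayMaekawa2010
Burgers columns; GallaySverak2024 rings; BedrossianCotizelatiVicol2019 depletion), Seregin's
axisymmetric Type-II Euler-scaling scenario (Seregin2024AxisymTypeII) as the limit object to kill. -/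
@[route_item "route-NavierStokesRegularity-TypeIIInviscidRelaxation", crux]
def MonopoleCoreExclusion : Prop :=
  (∀ ν : ℝ, 0 < ν → ∀ u₀ : EuclideanSpace ℝ (Fin 3) → EuclideanSpace ℝ (Fin 3), ContDiff ℝ (⊤ : ℕ∞) u₀ → Literature.Analysis.FluidPDE.VectorCalculus.IsDivFree u₀ → Literature.Analysis.FluidPDE.HasRapidSpatialDecay u₀ → (∀ (θ : ℝ) (x : EuclideanSpace ℝ (Fin 3)), u₀ (WithLp.toLp 2 ![Real.cos θ * x 0 - Real.sin θ * x 1, Real.sin θ * x 0 + Real.cos θ * x 1, x 2]) = WithLp.toLp 2 ![Real.cos θ * u₀ x 0 - Real.sin θ * u₀ x 1, Real.sin θ * u₀ x 0 + Real.cos θ * u₀ x 1, u₀ x 2]) → ∃ (u : ℝ → EuclideanSpace ℝ (Fin 3) → EuclideanSpace ℝ (Fin 3)) (p : ℝ → EuclideanSpace ℝ (Fin 3) → ℝ), Literature.Analysis.FluidPDE.IsClassicalNSSolutionOn (Set.Ici 0) ν 0 u p ∧ u 0 = u₀ ∧ Literature.Analysis.FluidPDE.HasBoundedEnergy u) → ∀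 (ν T : ℝ), 0 < ν → 0 < T → ∀ (u : ℝ → EuclideanSpace ℝ (Fin 3) → EuclideanSpace ℝ (Fin 3)) (p : ℝ → EuclideanSpace ℝ (Fin 3) → ℝ), Literature.Analysis.FluidPDE.IsMaximalSmoothSolution ν 0 u p T → Literature.Analysis.FluidPDE.IsLerayHopfOn T ν 0 (u 0) u → Literature.Analysis.FluidPDE.HasRapidSpatialDecay (u 0) → ¬ Literature.Analysis.FluidPDE.IsTypeIBlowup u T → (∀ K : ℝ, 0 < K → ∀ t₀ < T, ∃ t, t₀ < t ∧ t < T ∧ ∃ (x₀ : EuclideanSpace ℝ (Fin 3)) (L V : ℝ) (Q : EuclideanSpace ℝ (Fin 3) ≃ₗᵢ[ℝ] EuclideanSpace ℝ (Fin 3)) (W : EuclideanSpace ℝ (Fin 3) → EuclideanSpace ℝ (Fin 3)), 0 < L ∧ 0 < V ∧ (∀ (θ : ℝ) (x : EuclideanSpace ℝ (Fin 3)), W (WithLp.toLp 2 ![Real.cos θ * x 0 - Real.sin θ * x 1, Real.sin θ * x 0 + Real.cos θ * x 1, x 2]) = WithLp.toLp 2 ![Real.cos θ * W x 0 - Real.sin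 θ * W x 1, Real.sin θ * W x 0 + Real.cos θ * W x 1, W x 2]) ∧ (∀ x, ‖u t x‖ ≤ V) ∧ (∃ x₁, dist x₁ x₀ ≤ L ∧ V ≤ 2 * ‖u t x₁‖) ∧ (∃ y y' : EuclideanSpace ℝ (Fin 3), ‖y‖ ≤ 1 ∧ ‖y'‖ ≤ 1 ∧ (4 : ℝ)⁻¹ ≤ ‖W y - W y'‖) ∧ K * ν ≤ L * V ∧ ∀ y : EuclideanSpace ℝ (Fin 3), ‖y‖ ≤ K → ‖V⁻¹ • Q.symm (u t (x₀ + L • Q y)) - W y‖ ≤ K⁻¹) → False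

/-- item stmt-NavierStokesRegularity-1966 · crux · rank 5 · open · by planner
why it might fail: One-component/anisotropic criteria (CheminZhang2016, WangWuZhang2023, KukavicaRusinZiane2016) need GLOBAL scale-invariant integrability of u³ or ∂₃u, not V/K-columnarity on K core radii at sparse times; a filament collapse can stay columnar at core scale while strain at scales ≫KL drives growth.
sources: CheminZhang2016, WangWuZhang2023, KukavicaRusinZiane2016, arXiv:2606.08352, MoffattKimura2019, ConstantinFefferman1993
[crux] COLUMNAR / DIPOLE BRANCH (card's DP, widened from dipoles to all columnar profiles): no
finite-energy classical solution from Clay data with maximal lifespan T and non-Type-I rate admits,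
for every K>0 frequently as t↑T, level-K witnesses of the COLUMNAR class (W(y+τe₃)=W(y); same
witness clauses as TypeIICoreRelaxation). Heuristic: 2½-D flows (u_h solving 2-D Euler/NS, u₃
transported) never blow up, and a core that is K⁻¹-columnar on K core radii at Reynolds ≥K has
switched off vortex stretching at its own scale; Kerr's antiparallel class and Moffatt–Kimura tents
live here. Toolbox: one-component / anisotropic regularity criteria (CheminZhang2016 critical u³
criterion; WangWuZhang2023 scaling-invariant Serrin via one component; KukavicaRusinZiane2016
anisotropic partial regularity; arXiv:2606.08352 finite-scale one-component regularity via harmonic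
pressure), BKM/Constantin–Fefferman direction coherence (columnar ⇒ parallel vorticity directions at
the core scale, cf. route VorticityGeometry). -/
@[route_item "route-NavierStokesRegularity-TypeIIInviscidRelaxation", crux]
def ColumnarCoreExclusion : Prop :=
  ∀ (ν T : ℝ), 0 < ν → 0 < T → ∀ (u : ℝ → EuclideanSpace ℝ (Fin 3) → EuclideanSpace ℝ (Fin 3)) (p : ℝ → EuclideanSpace ℝ (Fin 3) → ℝ), Literature.Analysis.FluidPDE.IsMaximalSmoothSolution ν 0 u p T → Literature.Analysis.FluidPDE.IsLerayHopfOn T ν 0 (u 0) u → Literature.Analysis.FluidPDE.HasRapidSpatialDecay (u 0) → ¬ Literature.Analysis.FluidPDE.IsTypeIBlowup u T → (∀ K : ℝ, 0 < K → ∀ t₀ < T, ∃ t, t₀ < t ∧ t < T ∧ ∃ (x₀ : EuclideanSpace ℝ (Fin 3)) (L V : ℝ) (Q : EuclideanSpace ℝ (Fin 3) ≃ₗᵢ[ℝ] EuclideanSpace ℝ (Fin 3)) (W : EuclideanSpace ℝ (Fin 3) → EuclideanSpace ℝ (Fin 3)), 0 < L ∧ 0 < V ∧ (∀ (y : EuclideanSpace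 ℝ (Fin 3)) (τ : ℝ), W (y + τ • EuclideanSpace.single 2 1) = W y) ∧ (∀ x, ‖u t x‖ ≤ V) ∧ (∃ x₁, dist x₁ x₀ ≤ L ∧ V ≤ 2 * ‖u t x₁‖) ∧ (∃ y y' : EuclideanSpace ℝ (Fin 3), ‖y‖ ≤ 1 ∧ ‖y'‖ ≤ 1 ∧ (4 : ℝ)⁻¹ ≤ ‖W y - W y'‖) ∧ K * ν ≤ L * V ∧ ∀ y : EuclideanSpace ℝ (Fin 3), ‖y‖ ≤ K → ‖V⁻¹ • Q.symm (u t (x₀ + L • Q y)) - W y‖ ≤ K⁻¹) → False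

/-- item stmt-NavierStokesRegularity-19060 · crux · rank 6 · open · by planner
why it might fail: Scale-critical a-priori bound beyond the energy class (EnergySupercriticality applies); Hou's focusing jet (arXiv:2107.06509: u_r ≪ 0 below the ring of maximal u_θ) would make r|u_r|/ν unbounded near the axis as t↑T; no one-sided a-priori information on u_r is known (only |Γ| ≤ ‖Γ₀‖∞).
sources: Hou2022PotentiallySingularNS, arXiv:2405.10916, KochNadirashviliSereginSverak2009, LeiZhang2017, Tao2016AveragedNS, CaffarelliKohnNirenberg1982
[crux] A-PRIORI ONE-SIDED RADIAL INFLOW BOUND — piece X₂ of the strategist decomposition of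
AxisymSwirlRegular. For the same standing class (classical on [0,T), Leray–Hopf on [0,T] from the
datum, bounded on sub-slabs, axisymmetric slices, rapidly decaying datum) there are C and δ>0 with
x₀u₀+x₁u₁ = r u_r ≥ −Cν on {cylRadius<δ}×[0,T). Scale-invariant (r u_r/ν). A NECESSARY condition for
extension past T (a solution bounded up to T has r u_r ≥ −Mδ) not known to be sufficient
(sufficiency is OneSidedRadialCriterion, open for C ≥ 2): the only a-priori pointwise tool in the
class is the maximum principle |Γ| ≤ ‖Γ₀‖∞ for Γ = r u_θ, silent about u_r; energy gives only
log-measure smallness of {r u_r < −Cν}. Its NEGATION is the measurable blow-up signature of Hou's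
interior scenario (arXiv:2107.06509, arXiv:2405.10916): an inflow jet of unbounded local Reynolds
number r|u_r|/ν reaching the axis as t↑T — cheapest falsifier: evaluate inf r u_r/ν near the axis on
Hou's published profiles. Strengthens stmt-2899 InflowReynoldsBound (bound only on the
swirl-carrying set {|Γ| ≥ ν}) to the whole axis tube, which is what the modus ponens with
OneSidedRadialCriterion needs. Foreseen tools: kinemati -/
@[route_item "route-NavierStokesRegularity-TypeIIInviscidRelaxation"]
def AprioriRadialInflowBound : Prop :=
  ∀ (ν T : ℝ), 0 < ν → 0 < T → ∀ (u : ℝ → EuclideanSpace ℝ (Fin 3) → EuclideanSpace ℝ (Fin 3)) (p : ℝ → EuclideanSpace ℝ (Fin 3) → ℝ), Literature.Analysis.FluidPDE.IsClassicalNSSolutionOn (Set.Ico 0 T) ν 0 u p → Literature.Analysis.FluidPDE.IsLerayHopfOn T ν 0 (u 0) u → (∀ T' < T, ∃ M : ℝ, ∀ t ∈ Set.Icc 0 T', ∀ x, ‖u t x‖ ≤ M) → (∀ t ∈ Set.Ico 0 T, Literature.Analysis.FluidPDE.IsAxisymmetric (u t)) → Literature.Analysis.FluidPDE.HasRapidSpatialDecay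 (u 0) → ∃ C δ : ℝ, 0 < δ ∧ ∀ t ∈ Set.Ico 0 T, ∀ x, Literature.Analysis.FluidPDE.cylRadius x < δ → -(C * ν) ≤ x 0 * u t x 0 + x 1 * u t x 1

/-- item stmt-NavierStokesRegularity-19059 · crux · rank 7 · open · by planner
why it might fail: C ≥ 2 is open: no radial modulus is a supersolution there (thresholds: log 2−3/L, power r^α 2−α), KNSS's cut-off closes one-sidedly only for C<2, and every any-C result (KNSS Thm 5.3, CSTY2009) needs the TWO-sided |u| ≤ C/r; a focusing jet with bounded r u_r⁻ but unbounded u_z is not excluded.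
sources: KochNadirashviliSereginSverak2009, ChenStrainTsaiYau2009, KubicaPokornyZajaczkowski2011, arXiv:1206.4567, Kubica2015, LeiZhang2017
[crux] ONE-SIDED RADIAL (INFLOW) CRITERION WITH ARBITRARY CONSTANT — piece X₁ of the strategist
decomposition of AxisymSwirlRegular (verbatim the statement of stmt-NavierStokesRegularity-2898 of
the retired axisymmetric route KnvAxisInflow, refuter-checked 2026-08-15). For classical NS
solutions on [0,T) that are Leray–Hopf on [0,T] from their datum, bounded on sub-slabs [0,T']×ℝ³,
with axisymmetric slices and rapidly decaying datum: if for some C and δ>0 the radial momentum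
x₀u₀+x₁u₁ = r u_r is ≥ −Cν on {cylRadius<δ}×[0,T) (inflow toward the axis at most C-times critical;
outflow and axial velocity unrestricted), the solution extends smoothly past T. STATUS: the
two-sided |u| ≤ C/r (any C) criterion is KNSS2009 Thm 5.3 / ChenStrainTsaiYau2009; printed SIGNED
criteria penalise outflow u_r⁺ in weighted Serrin norms (KubicaPokornyZajaczkowski2011 =
arXiv:1206.4567 Thm 1, Kubica2015); C<2 follows modulo the Lei–Zhang axis criterion (LeiZhang2017
Cor 1.3, |Γ| ≤ C₁|ln r|⁻²) from the contact comparison with m = A/ln²(l/r) (KnvAxisInflow planner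
computation r m''/m' = 3/L − 1: breakthrough needs r u_r < −(2−3/L)ν); C ≥ 2 is OPEN and is the
content. Wang2013 (JDE 254 'The role of sign', pa -/
@[route_item "route-NavierStokesRegularity-TypeIIInviscidRelaxation", crux]
def OneSidedRadialCriterion : Prop :=
  ∀ (ν T : ℝ), 0 < ν → 0 < T → ∀ (u : ℝ → EuclideanSpace ℝ (Fin 3) → EuclideanSpace ℝ (Fin 3)) (p : ℝ → EuclideanSpace ℝ (Fin 3) → ℝ), Literature.Analysis.FluidPDE.IsClassicalNSSolutionOn (Set.Ico 0 T) ν 0 u p → Literature.Analysis.FluidPDE.IsLerayHopfOn T ν 0 (u 0) u → (∀ T' < T, ∃ M : ℝ, ∀ t ∈ Set.Icc 0 T', ∀ x, ‖u t x‖ ≤ M) → (∀ t ∈ Set.Ico 0 T, Literature.Analysis.FluidPDE.IsAxisymmetric (u t)) → Literature.Analysis.FluidPDE.HasRapidSpatialDecay (u 0) → (∃ C δ : ℝ, 0 < δ ∧ ∀ t ∈ Set.Ico 0 T, ∀ x, Literature.Analysis.FluidPDE.cylRadius x < δ → -(C * ν) ≤ x 0 * u t x 0 + x 1 * u t x 1)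 → Literature.Analysis.FluidPDE.HasSmoothExtensionPast ν 0 u T

/-- item stmt-NavierStokesRegularity-0055 · support · rank 9 · closed · proved by Summit.NavierStokesRegularity.NavierStokesRegularity.Theorems.typeICertificateLadder_noBlowupToClay_proof @ 8d57e70af7e2 (prover) · by planner
sources: Leray1934, KochNadirashviliSereginSverak2009
Given NoBlowup, build the Clay (A) solution: local finite-energy classical solution for smooth
divergence-free rapidly decaying data (Leray 1934 §III / Fujita–Kato 1964 + LPS smoothing), continue
past every T using NoBlowup, glue by weak–strong uniqueness (Prodi–Serrin), bounded energy from the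
energy inequality, and convert with
Literature.Analysis.FluidPDE.isNavierStokesSolution_and_smooth_iff. Blow-up at spatial infinity is
excluded by CKN ε-regularity applied far out. May take named Literature facts (leray_existence_R3,
ladyzhenskaya_prodi_serrin, weak_strong_uniqueness, fujita_kato_local) as hypotheses if the grounder
so rules. -/
@[route_item "route-NavierStokesRegularity-TypeIIInviscidRelaxation", crux]
def NoBlowupToClay : Prop :=
  (∀ (ν T : ℝ), 0 < ν → 0 < T → ∀ (u : ℝ → EuclideanSpace ℝ (Fin 3) → EuclideanSpace ℝ (Fin 3)) (p : ℝ → EuclideanSpace ℝ (Fin 3) → ℝ), Literature.Analysis.FluidPDE.IsClassicalNSSolutionOn (Set.Ico 0 T) ν 0 u p → Literature.Analysis.FluidPDE.IsLerayHopfOn T ν 0 (u 0) u → Literature.Analysis.FluidPDE.HasRapidSpatialDecay (u 0) → Literature.Analysis.FluidPDE.HasSmoothExtensionPast ν 0 u T) → NavierStokesRegularity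

/-- `NoBlowupToClay` holds: proved by `Summit.NavierStokesRegularity.NavierStokesRegularity.Theorems.typeICertificateLadder_noBlowupToClay_proof` @ 8d57e70af7e2. -/
theorem NoBlowupToClay_holds : NoBlowupToClay := _root_.Summit.NavierStokesRegularity.NavierStokesRegularity.Theorems.typeICertificateLadder_noBlowupToClay_proof

/-- item stmt-NavierStokesRegularity-1217 · support · rank 9 · open · by planner
sources: KochNadirashviliSereginSverak2009, AlbrittonBarker2019, SereginSverak2009
[target] X = NO TYPE-I BLOW-UP FOR CLAY DATA: a classical solution of unforced NS on ℝ³×[0,T) which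
is Leray–Hopf from a rapidly decaying datum and blows up at most at the Type-I rate ‖u(t)‖∞ ≤
C(T−t)^{-1/2} extends smoothly past T. Equals UnthreadedNoBlowup ∧ ThreadedNoBlowup by excluded
middle on 'every point is unthreaded' (proved in the planner's Sketch.lean: target_of_cruxes); it is
the unconditional conclusion of stmt-NavierStokesRegularity-0058 (route TypeILiouville, which
assumes (L)). With NoTypeII (stmt-0056) it gives NoBlowup (stmt-0054). Card:
threading-flux-trace-topology. -/
@[route_item "route-NavierStokesRegularity-TypeIIInviscidRelaxation", crux]
def NoTypeIBlowup : Prop :=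
  ∀ (ν T : ℝ), 0 < ν → 0 < T → ∀ (u : ℝ → EuclideanSpace ℝ (Fin 3) → EuclideanSpace ℝ (Fin 3)) (p : ℝ → EuclideanSpace ℝ (Fin 3) → ℝ), Literature.Analysis.FluidPDE.IsClassicalNSSolutionOn (Set.Ico 0 T) ν 0 u p → Literature.Analysis.FluidPDE.IsLerayHopfOn T ν 0 (u 0) u → Literature.Analysis.FluidPDE.HasRapidSpatialDecay (u 0) → Literature.Analysis.FluidPDE.IsTypeIBlowup u T → Literature.Analysis.FluidPDE.HasSmoothExtensionPast ν 0 u T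

/-- item stmt-NavierStokesRegularity-1962 · assembly · rank 1 · closed · proved by Summit.NavierStokesRegularity.NavierStokesRegularity.Theorems.typeIIInviscidRelaxation_assembly_proof (prover) · by planner
sources: KochNadirashviliSereginSverak2009
[assembly] TypeIICoreRelaxation → AxisymSwirlRegular → MonopoleCoreExclusion → ColumnarCoreExclusion
→ NoTypeIBlowup → NoBlowupToClay → NavierStokesRegularity. PURE LOGIC, already proved in the
planner's Sketch.lean (theorem assembly_holds): given a classical Leray–Hopf solution from Clay data
on [0,T) with no smooth extension, it is maximal; if Type I, NoTypeIBlowup extends it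
(contradiction); if not Type I, TypeIICoreRelaxation gives witnesses of class (axisymmetric ∨
columnar) frequently at every level K; witnesses are monotone in K (K'≥K ⇒ a level-K' witness is a
level-K witness: Kν ≤ K'ν ≤ LV, ‖y‖≤K ⇒ ‖y‖≤K', K'⁻¹ ≤ K⁻¹), hence either axisymmetric witnesses
occur frequently at every level (→ MonopoleCoreExclusion, fed AxisymSwirlRegular) or columnar ones
do (→ ColumnarCoreExclusion); so NoBlowup holds and NoBlowupToClay (= stmt-0055) gives Clay (A).
Proof script available in the planner folder (Sketch.lean) — copy it. -/
@[route_item "route-NavierStokesRegularity-TypeIIInviscidRelaxation"]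
def Assembly : Prop :=
  TypeIICoreRelaxation → AxisymSwirlRegular → MonopoleCoreExclusion → ColumnarCoreExclusion → NoTypeIBlowup → NoBlowupToClay → NavierStokesRegularity

-- `Assembly` holds: proved by `Summit.NavierStokesRegularity.NavierStokesRegularity.Theorems.typeIIInviscidRelaxation_assembly_proof` (its module imports this route file, so no `_holds` link can be stated here).

/-! D-0027 §2.1 — DECIDING THEOREM (planner-authored via `route open/edit --closes-file`; by planner-rbadge-NavierStokesRegularity-TypeIIIn-defd1752-g2-0 2026-08-15T16:13:18Z):
its hypotheses are this route's items and its conclusion the sub-problem Statement (glue_lint), and it elaborates with this file. -/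

@[closes "route-NavierStokesRegularity-TypeIIInviscidRelaxation"] theorem closes : TypeIICoreRelaxation → AxisymSwirlRegular → MonopoleCoreExclusion →
    ColumnarCoreExclusion → NoTypeIBlowup → NoBlowupToClay → NavierStokesRegularity := by
  intro hR hAX hM hD hTI hClay
  refine hClay ?_
  intro ν T hν hT u p hcl hLH hdec
  by_contra hne
  have hmax : Literature.Analysis.FluidPDE.IsMaximalSmoothSolution ν 0 u p T := ⟨hcl, hne⟩
  by_cases hI : Literature.Analysis.FluidPDE.IsTypeIBlowup u T
  · exact hne (hTI ν T hν hT u p hcl hLH hdec hI)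
  · -- Type II case: relaxation dichotomy, then split frequently(axisym ∨ columnar) by monotonicity in K
    have hRw := hR ν T hν hT u p hmax hLH hdec hI
    have hM' := hM hAX ν T hν hT u p hmax hLH hdec hI
    have hD' := hD ν T hν hT u p hmax hLH hdec hI
    apply hD'
    intro K hK t₀ ht₀
    by_contra hnoD
    apply hM'
    intro K₁ hK₁ t₁ ht₁
    by_contra hnoA
    obtain ⟨t, ht, htT, x₀, L, V, Q, W, hL, hV, hclass, hbd, hatt, hosc, hRe, hclose⟩ :=
      hRw (max K K₁) (lt_max_of_lt_left hK) (max t₀ t₁) (max_lt ht₀ ht₁)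
    rcases hclass with hax | hcol
    · exact hnoA ⟨t, (le_max_right t₀ t₁).trans_lt ht, htT, x₀, L, V, Q, W, hL, hV, hax, hbd, hatt, hosc,
        (mul_le_mul_of_nonneg_right (le_max_right K K₁) hν.le).trans hRe,
        fun y hy => (hclose y (hy.trans (le_max_right K K₁))).trans (inv_anti₀ hK₁ (le_max_right K K₁))⟩
    · exact hnoD ⟨t, (le_max_left t₀ t₁).trans_lt ht, htT, x₀, L, V, Q, W, hL, hV, hcol, hbd, hatt, hosc,
        (mul_le_mul_of_nonneg_right (le_max_left K K₁) hν.le).trans hRe,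
        fun y hy => (hclose y (hy.trans (le_max_left K K₁))).trans (inv_anti₀ hK (le_max_left K K₁))⟩

end Summit.NavierStokesRegularity.NavierStokesRegularity.Theses.TypeIIInviscidRelaxation
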